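import Summits.RiemannHypothesis.RiemannHypothesis.Theses.ScrewLemmaKCoprofile
import HarnessLib

/-!
# Route ScrewLemmaKCoprofile (L17 «SCREW · LEMMA K CO-PROFILE») — `Assembly` (stmt-RiemannHypothesis-21615)

`CoprofileIsometry → CoprofileMoments → MomentGramFloor → ScrewSmoothSectorKSharp`: for an admissible `g` with
plateau `c = h₀` and co-profile `Φ_g`, the isometry gives `4π²(X + c²) = ∫Φ²` (`X = ∫(h−h₀)²/y²`), the moments give
`∫Φ = (π²/3)c` and the two orthogonality relations, and the Gram floor `36(∫Φ)² ≤ ∫Φ²` then reads `4π⁴c² ≤ ∫Φ²`,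
whence `(π² − 1)c² ≤ X` = LEMMA K♯. This is the planner's kernel-checked `assembly_proof` (rh-idea-5 g0,
pub/ideators/rh-idea-5/Sketch2.lean sha16 e4c7251dab66136f, over local copies of the same decls), written against
the route decls. RH-free real analysis; the cruxes `CoprofileIsometry`/`CoprofileMoments` stay OPEN; no summit is
proved by this; nothing here bears on the truth of RH.
-/

-- D-0017: `Summit.RiemannHypothesis.RiemannHypothesis.…` duplicates the namespace BY DESIGN (single-problem summit).
set_option linter.dupNamespace false

namespace Summit.RiemannHypothesis.RiemannHypothesis.Theorems.ScrewLemmaKCoprofile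

/-- **`Assembly` (item stmt-RiemannHypothesis-21615) holds**: isometry + moments + Gram floor ⇒ `(π²−1)h₀² ≤
∫(h−h₀)²/y²` for every admissible `g` (`nlinarith` bookkeeping; planner rh-idea-5's `assembly_proof`, e4c7251d).
RH-free. -/
theorem assembly_proof :
    Summit.RiemannHypothesis.RiemannHypothesis.Theses.ScrewLemmaKCoprofile.Assembly := by
  intro h1 h2 h3 g hg hint
  obtain ⟨hL2, hm0, hm1, hm2⟩ := h2 g hg
  have hG := h3 _ hL2 hm1 hm2
  have hI := h1 g hg hint
  rw [hm0] at hG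
  set X := (∫ y in Set.Ioo (0:ℝ) 1,
    (Summit.RiemannHypothesis.RiemannHypothesis.Theorems.IntegerScrew.latticeProfile g y -
      Summit.RiemannHypothesis.RiemannHypothesis.Theorems.IntegerScrew.latticePlateau g) ^ 2 / y ^ 2) with hX
  set P := (∫ t in Set.Ioo (0:ℝ) 1, (∑ n ∈ Finset.Icc 1 ⌊1 / t⌋₊, deriv g (n * t) / n) ^ 2) with hP
  set c := Summit.RiemannHypothesis.RiemannHypothesis.Theorems.IntegerScrew.latticePlateau g with hc
  have hpi : 0 < Real.pi ^ 2 := by positivity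
  have h4 : 4 * Real.pi ^ 2 * (X + c ^ 2) = P := by
    rw [hI]; field_simp
  have h5 : 4 * (Real.pi ^ 2) ^ 2 * c ^ 2 ≤ P := by nlinarith [hG]
  show (Real.pi ^ 2 - 1) * c ^ 2 ≤ X
  nlinarith [h4, h5, hpi, sq_nonneg c]

end Summit.RiemannHypothesis.RiemannHypothesis.Theorems.ScrewLemmaKCoprofile
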